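import Summits.Schanuel.Schanuel.Theorems.RootDecomp1ERadixCell01

/-!
# RootDecomp1ERadixCell — lens 2, generation 42 «THE FINITE-ORDER RADIX-2 CELL: count CONJUGATES, not degree» (lanes E-R19 (i) T below hyper + (iii) the transcendental weight log 2): S ITSELF on the pure-radix class {z_l = (v_l·log 2)·T^{e_l}, T real of FIXED finite exponential order} HYPOTHESIS-FREE and on the mixed radix class {z_l = (u_l + v_l log 2)·T^{e_l}} mod the ONE tree fact hX = ExplicitRatExpApprox — the Kummer-direction degree is paid by COUNTING the 𝔐 conjugates of 2^{1/𝔐} through the resultant norm Res_Y(Y^𝔐 − 2, F), never by a pair measure — continuation (RootDecomp1ERadixCell02): §2 two-level polynomial, conjugate factors, resultant norm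

(lens-2 g42 HOME kernel RadixCell.lean d9530aae…, 1851 l, imports tree RootDecomp1EUntwistedWall04 + RootDecomp1KFiniteOrderCell02 only; CLAIM L2067, ACK + CHECKLIST E-g42 L2069, NODE L2089 / REQUEST L2090, critic VERDICT L2095 (crit g8: CLEARED — ONE CELL, tiers 1+2 = one cell; lens-2 tally CELL ×4 (g37, g39, g41, g42); E-R20 closes the radix line; PORT GO `--supports stmt-Schanuel-31410`); port by census-1 gen 18 as `RootDecomp1ERadixCell01`–`08` along K's sections: 01 = §1 the radix field ℚ(2^{1/𝔐}) (`croot`, `zroot`, `broot`, `irreducible_X_pow_sub_two`, degree 𝔐); 02 = §2 the two-level polynomial, conjugate factors `Gfac`, the RESULTANT NORM `resNorm` (`map_resNorm` = ∏ conjugates, `resNorm_ne_zero`, degree / value / Mahler-measure bounds); 03 = §3 the radix curve point `radixPt`, germs, fibres, root and residue avoidance at transcendental parameters; 04 = §4 integral exponents at the collapse (`Mden`, `Aexp`, `Bexp`, the value of G₀, from avoidance to the hypotheses of `resNorm_ne_zero`); 05 = §5 THE PURE-RADIX ENGINE `algebraicIndependent_radixPt_pure` (hypothesis-free, `endgame_pure`)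 + §5b mixed-engine helpers; 06 = §5b THE MIXED ENGINE `algebraicIndependent_radixPt (hX)` (one 320-line theorem, scoped `maxHeartbeats 800000` carried as in K); 07 = §6 classes `InPureRadixClass` / `InRadixClass`, `schanuel_inPureRadixClass` (hyp-free) / `schanuel_inRadixClass (hX)`, cells `cell_31410(_pure)` / `cell_25020(_pure)`, members `zLog2Curve` / `zMix` at tower numbers; 08 = §6 items AT the members + separation (`zMix_not_inPointClass`, `zLog2Curve_not_inPointClass`, `zMix_separation`).
PORT EDITS: 37 one-line docstrings added; five generic helpers made `private` against dedup twins (`mahlerMeasure_finset_prod`, `eval_map_intCast`, `aeval_ne_zero_of_transcendental`, `addNat_eq_natAdd`, `transcendental_log_two` ≡ tree AclSubsetLogFreeCore/Negative) with per-part private copies; statements and proofs verbatim. `--supports stmt-Schanuel-31410`; no census credit carried; rung 0 — nothing here proves Schanuel.)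
-/

noncomputable section

open Complex Polynomial IntermediateField Filter
open scoped BigOperators Topology

namespace Summit.Schanuel.Schanuel.Theorems.RootDecomp1ERadixCell

open Summit.Schanuel.Schanuel.Theorems.RootDecomp1EUntwistedWall (gι gaussPt expo coef tail fib IsZ wden wden_pos
  isZ_expo Wb Wb_nonneg abs_expo_le abs_coef_le expo_eq_of_tail_eq sum_coef_fibre_cast fib_ne_zero diffPoly
  diffPoly_ne_zero eval_diffPoly gι_expo_sub gι_injective tail_eq_of_expo_eq eq_of_tail_eq_of_zero_eq coef_cast
  IsZ.add IsZ.mul IsZ.natCast IsZ.sum isZ_wden_fst isZ_wden_snd InGaussCurveClass)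
open Summit.Schanuel.Schanuel.Theorems.RootDecomp1EPointTransfer (InPointClass)
open Summit.Schanuel.Schanuel.Theorems.RootDecomp1ETwoScale (InTwoScaleClass)
open Summit.Schanuel.Schanuel.Theorems.RootDecomp1EWallDichotomy (InTwistedFrameClass)
open Summit.Schanuel.Schanuel.Theorems.RootDecomp1KHyper
open Summit.Schanuel.Schanuel.Theorems.RootDecomp1KHyper.HyperCell
open Summit.Schanuel.Schanuel.Theorems.RootDecomp1KGeneric (LiouvilleOrder)
open Summit.Schanuel.Schanuel.Theorems.RootDecomp1KFiniteOrderCell (towerNumber liouvilleOrder_towerNumber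
  not_hyperLiouville_towerNumber towerNumber_pos not_liouvilleOrder_towerNumber)
open Summit.Schanuel.Schanuel.Theorems.RootDecomp1BDefectFloorCells (natCast_le_trdeg_of_algebraicIndependent)

/-! ## §2  The two-level polynomial, its conjugate factors and the resultant norm -/

section TwoLevel

variable {σ : Type*}

/-- The TWO-LEVEL integer polynomial `F(X, Y) = Σ_s κ_s X^{A_s} Y^{B_s} ∈ ℤ[X][Y]`. -/
def twoLevel (S : Finset σ) (κ : σ → ℤ) (A B : σ → ℕ) : ℤ[X][X] :=
  ∑ s ∈ S, C (C (κ s) * X ^ A s) * X ^ B s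

/-- The `i`-th CONJUGATE FACTOR `G_i(X) = F(X, b_i) = Σ_s κ_s b_i^{B_s} X^{A_s} ∈ ℂ[X]`. -/
def Gfac (M : ℕ) (S : Finset σ) (κ : σ → ℤ) (A B : σ → ℕ) (i : ℕ) : ℂ[X] :=
  ∑ s ∈ S, C ((κ s : ℂ) * broot M i ^ B s) * X ^ A s

/-- THE RESULTANT NORM `R₀(X) = Res_Y(Y^𝔐 − 2, F(X, Y)) ∈ ℤ[X]`. -/
def resNorm (M : ℕ) (S : Finset σ) (κ : σ → ℤ) (A B : σ → ℕ) : ℤ[X] :=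
  resultant (X ^ M - C (C 2)) (twoLevel S κ A B) M (twoLevel S κ A B).natDegree

/-- The coefficient map `ℤ[X] → ℂ[X]` as a ring hom on the outer variable. -/
abbrev ψ : ℤ[X] →+* ℂ[X] := mapRingHom (Int.castRingHom ℂ)

/-- Evaluating the two-level polynomial at `Y = ζ^i c_𝔐` gives the `i`-th conjugate factor `Gfac i`. -/
theorem map_twoLevel_eval (M : ℕ) (S : Finset σ) (κ : σ → ℤ) (A B : σ → ℕ) (i : ℕ) :
    ((twoLevel S κ A B).map ψ).eval (C (broot M i)) = Gfac M S κ A B i := by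
  simp only [twoLevel, Gfac, Polynomial.map_sum, eval_finsetSum]
  refine Finset.sum_congr rfl fun s _ => ?_
  simp only [Polynomial.map_mul, Polynomial.map_pow, map_X, Polynomial.map_C, coe_mapRingHom, eval_mul,
    eval_pow, eval_X, eval_C, Polynomial.map_intCast, eq_intCast, C_mul, C_pow, map_intCast, eval_intCast]
  ring

/-- `Y^𝔐 − 2` splits over `ℂ[X]` into the conjugate factors `Y − b_i`. -/
theorem X_pow_sub_two_eq_prod {M : ℕ} (hM : 0 < M) :
    (X ^ M - C (C (2 : ℂ)) : ℂ[X][X]) = ∏ i ∈ Finset.range M, (X - C (C (broot M i))) := by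
  have hζ : IsPrimitiveRoot (C (zroot M) : ℂ[X]) M := (isPrimitiveRoot_zroot hM.ne').map_of_injective C_injective
  have e : (C (croot M : ℂ) : ℂ[X]) ^ M = C (2 : ℂ) := by
    rw [← C_pow, ← Complex.ofReal_pow, croot_pow hM.ne']; norm_num
  rw [X_pow_sub_C_eq_prod hζ hM e]
  refine Finset.prod_congr rfl fun i _ => ?_
  rw [broot, ← C_pow, ← C_mul]

/-- **KEY IDENTITY — the resultant norm is the product of the conjugate factors:**
`R₀ ↦ ℂ[X]` equals `∏_{i<𝔐} G_i`. -/
theorem map_resNorm {M : ℕ} (hM : 0 < M) (S : Finset σ) (κ : σ → ℤ) (A B : σ → ℕ) :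
    (resNorm M S κ A B).map (Int.castRingHom ℂ) = ∏ i ∈ Finset.range M, Gfac M S κ A B i := by
  have hn : ((twoLevel S κ A B).map ψ).natDegree ≤ (twoLevel S κ A B).natDegree := natDegree_map_le
  have h1 := resultant_map_map (X ^ M - C (C (2 : ℤ)) : ℤ[X][X]) (twoLevel S κ A B) M
    (twoLevel S κ A B).natDegree ψ
  have hf : ((X ^ M - C (C (2 : ℤ)) : ℤ[X][X]).map ψ) = X ^ M - C (C (2 : ℂ)) := by
    rw [Polynomial.map_sub, Polynomial.map_pow, map_X, Polynomial.map_C, coe_mapRingHom, Polynomial.map_C,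
      eq_intCast, Int.cast_ofNat]
  have hdeg : (∏ i ∈ Finset.range M, (X - C (C (broot M i))) : ℂ[X][X]).natDegree = M := by
    rw [natDegree_prod_of_monic _ _ fun i _ => monic_X_sub_C _]
    simp
  have h2 := resultant_prod_left (Finset.range M) (fun i => (X - C (C (broot M i)) : ℂ[X][X]))
    ((twoLevel S κ A B).map ψ) (twoLevel S κ A B).natDegree (by simp [leadingCoeff_X_sub_C]) hn
  rw [hdeg] at h2
  simp_rw [natDegree_X_sub_C, resultant_X_sub_C_left _ _ _ hn, map_twoLevel_eval] at h2
  rw [resNorm, ← coe_mapRingHom, ← h1, hf, X_pow_sub_two_eq_prod hM, h2]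

/-- The `A₀`-SLICE of `F`, reduced modulo `Y^𝔐 = 2`:
`H_{A₀}(Y) = Σ_{s : A_s = A₀} κ_s 2^{⌊B_s/𝔐⌋} Y^{B_s mod 𝔐} ∈ ℤ[Y]`, of degree `< 𝔐`. -/
def slice (M : ℕ) (S : Finset σ) (κ : σ → ℤ) (A B : σ → ℕ) (A₀ : ℕ) : ℤ[X] :=
  ∑ s ∈ S with A s = A₀, C (κ s * 2 ^ (B s / M)) * X ^ (B s % M)

/-- Reduction of powers of a conjugate root: `(ζ^i c)^k = 2^{k/𝔐} · (ζ^i c)^{k % 𝔐}`. -/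
theorem broot_pow_eq {M : ℕ} (hM : M ≠ 0) (i k : ℕ) :
    broot M i ^ k = (2 : ℂ) ^ (k / M) * broot M i ^ (k % M) := by
  conv_lhs => rw [← Nat.div_add_mod k M, pow_add, pow_mul, broot_pow hM]

/-- The `A₀`-th coefficient of the conjugate factor `G_i` is the slice evaluated at `b_i`. -/
theorem coeff_Gfac {M : ℕ} (hM : M ≠ 0) (S : Finset σ) (κ : σ → ℤ) (A B : σ → ℕ) (i A₀ : ℕ) :
    (Gfac M S κ A B i).coeff A₀ = aeval (broot M i) (slice M S κ A B A₀) := by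
  rw [Gfac, finsetSum_coeff, slice, map_sum, Finset.sum_filter]
  refine Finset.sum_congr rfl fun s _ => ?_
  rw [coeff_C_mul, coeff_X_pow]
  by_cases h : A s = A₀
  · rw [if_pos h.symm, if_pos h, mul_one, map_mul, map_pow, aeval_X, aeval_C, algebraMap_int_eq, eq_intCast,
      broot_pow_eq hM i (B s)]
    push_cast; ring
  · rw [if_neg (Ne.symm h), if_neg h, mul_zero]

/-- Each `Y`-slice of the two-level polynomial has `Y`-degree `< 𝔐`. -/
theorem natDegree_slice_lt {M : ℕ} (hM : 0 < M) (S : Finset σ) (κ : σ → ℤ) (A B : σ → ℕ) (A₀ : ℕ) :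
    (slice M S κ A B A₀).natDegree < M := by
  rw [slice]
  refine lt_of_le_of_lt (natDegree_sum_le_of_forall_le _ _ (n := M - 1) fun s _ => ?_) (by omega)
  refine (natDegree_C_mul_X_pow_le _ _).trans ?_
  have := Nat.mod_lt (B s) hM
  omega

/-- The coefficients of a `Y`-slice: a sum over the fibre `A s = A₀ ∧ B s % 𝔐 = ρ₀`. -/
theorem coeff_slice (M : ℕ) (S : Finset σ) (κ : σ → ℤ) (A B : σ → ℕ) (A₀ ρ₀ : ℕ) :
    (slice M S κ A B A₀).coeff ρ₀ = ∑ s ∈ S with (A s = A₀ ∧ B s % M = ρ₀), κ s * 2 ^ (B s / M) := by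
  rw [slice, finsetSum_coeff, Finset.sum_filter, Finset.sum_filter]
  refine Finset.sum_congr rfl fun s _ => ?_
  rw [coeff_C_mul_X_pow]
  by_cases h1 : A s = A₀
  · by_cases h2 : B s % M = ρ₀
    · rw [if_pos h1, if_pos h2.symm, if_pos ⟨h1, h2⟩]
    · rw [if_pos h1, if_neg (Ne.symm h2), if_neg (fun h => h2 h.2)]
  · rw [if_neg h1, if_neg (fun h => h1 h.1)]

/-- RESIDUE AVOIDANCE ⇒ the slice through `s₀` is non-zero: if, among the terms with `A_s = A_{s₀}`, the residue
`B_s mod 𝔐` determines `B_s`, and the cell sum `Σ_{(A_s,B_s) = (A_{s₀},B_{s₀})} κ_s ≠ 0`, then `H_{A_{s₀}} ≠ 0`. -/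
theorem slice_ne_zero (M : ℕ) {S : Finset σ} {κ : σ → ℤ} {A B : σ → ℕ} {s₀ : σ}
    (hres : ∀ s ∈ S, A s = A s₀ → B s % M = B s₀ % M → B s = B s₀)
    (hsum : (∑ s ∈ S with (A s = A s₀ ∧ B s = B s₀), κ s) ≠ 0) : slice M S κ A B (A s₀) ≠ 0 := by
  intro h0
  have hc := congrArg (fun p : ℤ[X] => p.coeff (B s₀ % M)) h0
  simp only [coeff_zero] at hc
  rw [coeff_slice] at hc
  have hset : (S.filter fun s => A s = A s₀ ∧ B s % M = B s₀ % M) =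
      S.filter fun s => A s = A s₀ ∧ B s = B s₀ := by
    ext s
    simp only [Finset.mem_filter]
    constructor
    · rintro ⟨hs, h1, h2⟩; exact ⟨hs, h1, hres s hs h1 h2⟩
    · rintro ⟨hs, h1, h2⟩; exact ⟨hs, h1, by rw [h2]⟩
  rw [hset] at hc
  have hc' : (∑ s ∈ S with (A s = A s₀ ∧ B s = B s₀), κ s) * 2 ^ (B s₀ / M) = 0 := by
    rw [Finset.sum_mul, ← hc]
    refine Finset.sum_congr rfl fun s hs => ?_
    rw [(Finset.mem_filter.mp hs).2.2]
  exact hsum ((mul_eq_zero.mp hc').resolve_right (pow_ne_zero _ (by norm_num)))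

/-- **Every conjugate factor is non-zero** under residue avoidance. -/
theorem Gfac_ne_zero {M : ℕ} (hM : 0 < M) {S : Finset σ} {κ : σ → ℤ} {A B : σ → ℕ} {s₀ : σ}
    (hres : ∀ s ∈ S, A s = A s₀ → B s % M = B s₀ % M → B s = B s₀)
    (hsum : (∑ s ∈ S with (A s = A s₀ ∧ B s = B s₀), κ s) ≠ 0) (i : ℕ) : Gfac M S κ A B i ≠ 0 := by
  intro h0
  have hc := congrArg (fun p : ℂ[X] => p.coeff (A s₀)) h0
  simp only [coeff_zero] at hc
  rw [coeff_Gfac hM.ne'] at hc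
  exact aeval_broot_ne_zero hM i (slice_ne_zero M hres hsum) (natDegree_slice_lt hM S κ A B _) hc

/-- **THE RESULTANT NORM IS A NON-ZERO INTEGER POLYNOMIAL** under residue avoidance. -/
theorem resNorm_ne_zero {M : ℕ} (hM : 0 < M) {S : Finset σ} {κ : σ → ℤ} {A B : σ → ℕ} {s₀ : σ}
    (hres : ∀ s ∈ S, A s = A s₀ → B s % M = B s₀ % M → B s = B s₀)
    (hsum : (∑ s ∈ S with (A s = A s₀ ∧ B s = B s₀), κ s) ≠ 0) : resNorm M S κ A B ≠ 0 := by
  intro h0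
  have h := map_resNorm hM S κ A B
  rw [h0, Polynomial.map_zero] at h
  exact Finset.prod_ne_zero_iff.mpr (fun i _ => Gfac_ne_zero hM hres hsum i) h.symm

/-! ### Degree, values and Mahler measure of the resultant norm -/

/-- Degree bound of the conjugate factors: `natDegree (Gfac i) ≤ max A`. -/
theorem natDegree_Gfac_le (M : ℕ) {S : Finset σ} (κ : σ → ℤ) {A : σ → ℕ} (B : σ → ℕ) {Amax : ℕ}
    (hA : ∀ s ∈ S, A s ≤ Amax) (i : ℕ) : (Gfac M S κ A B i).natDegree ≤ Amax := by
  rw [Gfac]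
  exact natDegree_sum_le_of_forall_le _ _ fun s hs => (natDegree_C_mul_X_pow_le _ _).trans (hA s hs)

/-- Degree bound of the resultant norm: `natDegree R₀ ≤ 𝔐 · max A`. -/
theorem natDegree_resNorm_le {M : ℕ} (hM : 0 < M) {S : Finset σ} (κ : σ → ℤ) {A : σ → ℕ} (B : σ → ℕ)
    {Amax : ℕ} (hA : ∀ s ∈ S, A s ≤ Amax) : (resNorm M S κ A B).natDegree ≤ M * Amax := by
  rw [← natDegree_map_eq_of_injective (RingHom.injective_int (Int.castRingHom ℂ)), map_resNorm hM]
  refine (natDegree_prod_le _ _).trans ?_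
  calc ∑ i ∈ Finset.range M, (Gfac M S κ A B i).natDegree ≤ ∑ _i ∈ Finset.range M, Amax :=
        Finset.sum_le_sum fun i _ => natDegree_Gfac_le M κ B hA i
    _ = M * Amax := by rw [Finset.sum_const, Finset.card_range, smul_eq_mul]

/-- The Mahler measure of a finite product is the product of the Mahler measures. -/
private theorem mahlerMeasure_finset_prod {ι : Type*} (s : Finset ι) (f : ι → ℂ[X]) :
    (∏ i ∈ s, f i).mahlerMeasure = ∏ i ∈ s, (f i).mahlerMeasure := by
  classical
  induction s using Finset.induction with
  | empty => simp
  | insert a s has ih => rw [Finset.prod_insert has, Finset.prod_insert has, mahlerMeasure_mul, ih]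

/-- `‖G_i(x)‖ ≤ Σ_s |κ_s| c_𝔐^{B_s} x^{A_s}` for real `x ≥ 0`. -/
theorem norm_eval_Gfac_le {M : ℕ} (hM : M ≠ 0) (S : Finset σ) (κ : σ → ℤ) (A B : σ → ℕ) (i : ℕ) {x : ℝ}
    (hx : 0 ≤ x) : ‖(Gfac M S κ A B i).eval (x : ℂ)‖ ≤ ∑ s ∈ S, |(κ s : ℝ)| * croot M ^ B s * x ^ A s := by
  rw [Gfac, eval_finsetSum]
  refine (norm_sum_le _ _).trans (Finset.sum_le_sum fun s _ => ?_)
  rw [eval_mul, eval_pow, eval_C, eval_X, norm_mul, norm_mul, norm_pow, norm_pow, norm_broot hM,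
    Complex.norm_intCast, Complex.norm_real, Real.norm_of_nonneg hx]

/-- `M(G_i) ≤ L₁(G_i) ≤ Σ_s |κ_s| c_𝔐^{B_s}`. -/
theorem mahlerMeasure_Gfac_le {M : ℕ} (hM : M ≠ 0) (S : Finset σ) (κ : σ → ℤ) (A B : σ → ℕ) (i : ℕ) :
    (Gfac M S κ A B i).mahlerMeasure ≤ ∑ s ∈ S, |(κ s : ℝ)| * croot M ^ B s := by
  refine (mahlerMeasure_le_sum_norm_coeff _).trans ?_
  rw [Polynomial.sum_def]
  have hcoeff : ∀ j, ‖(Gfac M S κ A B i).coeff j‖ ≤ ∑ s ∈ S with A s = j, |(κ s : ℝ)| * croot M ^ B s := by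
    intro j
    rw [Gfac, finsetSum_coeff, Finset.sum_filter]
    refine (norm_sum_le _ _).trans (Finset.sum_le_sum fun s _ => ?_)
    rw [coeff_C_mul, coeff_X_pow]
    by_cases h : A s = j
    · rw [if_pos h.symm, if_pos h, mul_one, norm_mul, norm_pow, norm_broot hM, Complex.norm_intCast]
    · rw [if_neg (Ne.symm h), if_neg h, mul_zero, norm_zero]
  refine (Finset.sum_le_sum fun j _ => hcoeff j).trans ?_
  rw [Finset.sum_fiberwise_eq_sum_filter]
  exact Finset.sum_le_sum_of_subset_of_nonneg (Finset.filter_subset _ _) fun s _ _ =>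
    mul_nonneg (abs_nonneg _) (pow_nonneg (croot_pos M).le _)

/-- `M(R₀) = ∏_i M(G_i) ≤ L^𝔐` whenever each `Σ_s |κ_s| c_𝔐^{B_s} ≤ L`. -/
theorem mahlerMeasure_resNorm_le {M : ℕ} (hM : 0 < M) (S : Finset σ) (κ : σ → ℤ) (A B : σ → ℕ) {L : ℝ}
    (hL : ∑ s ∈ S, |(κ s : ℝ)| * croot M ^ B s ≤ L) :
    ((resNorm M S κ A B).map (Int.castRingHom ℂ)).mahlerMeasure ≤ L ^ M := by
  rw [map_resNorm hM, mahlerMeasure_finset_prod]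
  calc ∏ i ∈ Finset.range M, (Gfac M S κ A B i).mahlerMeasure ≤ ∏ _i ∈ Finset.range M, L :=
        Finset.prod_le_prod (fun i _ => mahlerMeasure_nonneg _) fun i _ => (mahlerMeasure_Gfac_le hM.ne' S κ A B i).trans hL
    _ = L ^ M := by rw [Finset.prod_const, Finset.card_range]

/-- `eval x (P.map (Int.castRingHom ℂ)) = aeval x P` for an integer polynomial `P`. -/
private theorem eval_map_intCast (P : ℤ[X]) (x : ℂ) : (P.map (Int.castRingHom ℂ)).eval x = aeval x P := by
  rw [Polynomial.eval_map, Polynomial.aeval_def, algebraMap_int_eq]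

/-- `‖R₀(x)‖ = ∏_i ‖G_i(x)‖`. -/
theorem norm_aeval_resNorm {M : ℕ} (hM : 0 < M) (S : Finset σ) (κ : σ → ℤ) (A B : σ → ℕ) (x : ℂ) :
    ‖aeval x (resNorm M S κ A B)‖ = ∏ i ∈ Finset.range M, ‖(Gfac M S κ A B i).eval x‖ := by
  rw [← eval_map_intCast, map_resNorm hM, eval_prod, norm_prod]

end TwoLevel

end Summit.Schanuel.Schanuel.Theorems.RootDecomp1ERadixCell

end
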